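import Summits.CriticalPhenomena.PercolationContinuityZ3.Theorems.PercNearOneGluingNoHeavyLowerTailSahiOneStepFibreF3CheckDefs
import HarnessLib

/-!
# One-step scheme: the fibre-form checks for FIVE free coordinates, `|D₁| = 3` (computational, `native_decide`)

Computational support file (prover prim-ineq-prove-3 gen 16; `--supports stmt-CriticalPhenomena-4575`, `--computational`; memo
`run/shared/lean/prim/prim-ineq-prove-3/FINDING-G16-FIBRE-MAJ5.md` §3.6, §3.8).  `checkFive 3 θ = true` (`…FibreF3CheckDefs`) for `θ = 1, …, 5`
by `native_decide` (7581² pairs of upper families of `P(range 5)`; ≈ 45 s per threshold in the interpreter).  Soundness of the checker is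
`…FibreF3CheckSound.checkFive_sound`.
-/

namespace Summit.CriticalPhenomena.PercolationContinuityZ3.Theorems

namespace SahiOneStep

/-- **The three-copy fibre forms `(d1, d2) = (3, 2)` pass the checker for every threshold `1 ≤ θ ≤ 5`.** [this work, by computation] -/
theorem checkFive_d3 : ∀ θ ∈ Finset.range 6, 1 ≤ θ → checkFive 3 θ = true := by
  native_decide

end SahiOneStep

end Summit.CriticalPhenomena.PercolationContinuityZ3.Theorems
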